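/-
Copyright (c) 2026. All rights reserved.
Released under Apache 2.0 license as described in the file LICENSE.
-/
import Mathlib

/-!
# Stabiliser indices and element orders for two-point actions (arithmetic part)

The solutions of `1/e₁ + 1/e₂ + 1/e₃ = 1 + 2/N` with `eᵢ ≥ 2`, keeping the `eᵢ`: some `N/eᵢ = 2`,
or `N ∈ {12, 24, 60}` with every `eᵢ` in `{2,3}`, `{2,3,4}` (`N = 24`), `{2,3,5}` (`N = 60`);
and the group-theoretic transfer `K ⊴ Γ`, `K ≤ S`, `|S| = |K| e` ⇒ `γ ^ e ∈ K` for `γ ∈ S`.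
Used by `TwoPointActionsSharp`.

VALUE = THEOREM (elementary), NOT summit progress; the crux item is untouched.
-/

set_option linter.dupNamespace false

namespace Summit.MatrixMultiplication.MatrixMultiplication.Theorems.SubgroupIdentityDesigns.Negative

section TwoPointOrders

/-! ### The arithmetic of `Σ 1/eᵢ = 1 + 2/N`, keeping the `eᵢ` -/

/-- Ordered core case with the `eᵢ` recorded: `e₁ = 2`, `e₂ = 3`. -/
theorem arith3_core_sharp {N m₁ m₂ m₃ e₃ : ℕ} (h₁ : m₁ * 2 = N) (h₂ : m₂ * 3 = N)
    (h₃ : m₃ * e₃ = N) (he₃ : 2 ≤ e₃) (hs : m₁ + m₂ + m₃ = N + 2) :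
    m₃ = 2 ∨ m₂ = 2 ∨ (N = 12 ∧ e₃ = 3) ∨ (N = 24 ∧ e₃ = 4) ∨ (N = 60 ∧ e₃ = 5) := by
  have h6 : 6 * m₃ = N + 12 := by omega
  have he : e₃ ≤ 5 := by
    by_contra h
    push Not at h
    nlinarith
  interval_cases e₃ <;> omega

/-- The admissible stabiliser indices in the exceptional branch. -/
theorem admissible_of_core {N e : ℕ}
    (h : (N = 12 ∧ e = 3) ∨ (N = 24 ∧ e = 4) ∨ (N = 60 ∧ e = 5)) :
    (N = 12 ∨ N = 24 ∨ N = 60) ∧ (e = 2 ∨ e = 3 ∨ (e = 4 ∧ N = 24) ∨ (e = 5 ∧ N = 60)) := by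
  omega

/-- Ordered case with the `eᵢ` recorded: `e₁ = 2`. -/
theorem arith3_half_sharp {N m₁ m₂ m₃ e₂ e₃ : ℕ} (h₁ : m₁ * 2 = N) (h₂ : m₂ * e₂ = N)
    (h₃ : m₃ * e₃ = N) (he₂ : 2 ≤ e₂) (he₃ : 2 ≤ e₃) (hs : m₁ + m₂ + m₃ = N + 2) :
    m₁ = 2 ∨ m₂ = 2 ∨ m₃ = 2 ∨
      ((N = 12 ∨ N = 24 ∨ N = 60) ∧
        (e₂ = 2 ∨ e₂ = 3 ∨ (e₂ = 4 ∧ N = 24) ∨ (e₂ = 5 ∧ N = 60)) ∧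
        (e₃ = 2 ∨ e₃ = 3 ∨ (e₃ = 4 ∧ N = 24) ∨ (e₃ = 5 ∧ N = 60))) := by
  rcases Nat.lt_or_ge e₂ 3 with l₂ | l₂
  · have : e₂ = 2 := by omega
    subst this
    right; right; left; omega
  rcases Nat.lt_or_ge e₃ 3 with l₃ | l₃
  · have : e₃ = 2 := by omega
    subst this
    right; left; omega
  rcases Nat.lt_or_ge e₂ 4 with k₂ | k₂
  · have : e₂ = 3 := by omega
    subst this
    rcases arith3_core_sharp h₁ h₂ h₃ he₃ hs with h | h | h
    · exact Or.inr (Or.inr (Or.inl h))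
    · exact Or.inr (Or.inl h)
    · obtain ⟨hN, hE⟩ := admissible_of_core h
      exact Or.inr (Or.inr (Or.inr ⟨hN, Or.inr (Or.inl rfl), hE⟩))
  rcases Nat.lt_or_ge e₃ 4 with k₃ | k₃
  · have : e₃ = 3 := by omega
    subst this
    have hs' : m₁ + m₃ + m₂ = N + 2 := by omega
    rcases arith3_core_sharp h₁ h₃ h₂ he₂ hs' with h | h | h
    · exact Or.inr (Or.inl h)
    · exact Or.inr (Or.inr (Or.inl h))
    · obtain ⟨hN, hE⟩ := admissible_of_core h
      exact Or.inr (Or.inr (Or.inr ⟨hN, hE, Or.inr (Or.inl rfl)⟩))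
  -- `e₂, e₃ ≥ 4`: impossible
  exfalso
  nlinarith

/-- **The solutions of `1/e₁ + 1/e₂ + 1/e₃ = 1 + 2/N` with `eᵢ ≥ 2`, sharp form**: some orbit has
size `2`, or `N ∈ {12, 24, 60}` and every `eᵢ` lies in `{2, 3}`, `{2, 3, 4}` (`N = 24`),
`{2, 3, 5}` (`N = 60`). -/
theorem arith3_sharp {N m₁ m₂ m₃ e₁ e₂ e₃ : ℕ} (h₁ : m₁ * e₁ = N) (h₂ : m₂ * e₂ = N)
    (h₃ : m₃ * e₃ = N) (he₁ : 2 ≤ e₁) (he₂ : 2 ≤ e₂) (he₃ : 2 ≤ e₃)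
    (hs : m₁ + m₂ + m₃ = N + 2) :
    m₁ = 2 ∨ m₂ = 2 ∨ m₃ = 2 ∨
      ((N = 12 ∨ N = 24 ∨ N = 60) ∧
        (e₁ = 2 ∨ e₁ = 3 ∨ (e₁ = 4 ∧ N = 24) ∨ (e₁ = 5 ∧ N = 60)) ∧
        (e₂ = 2 ∨ e₂ = 3 ∨ (e₂ = 4 ∧ N = 24) ∨ (e₂ = 5 ∧ N = 60)) ∧
        (e₃ = 2 ∨ e₃ = 3 ∨ (e₃ = 4 ∧ N = 24) ∨ (e₃ = 5 ∧ N = 60))) := by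
  rcases Nat.lt_or_ge e₁ 3 with l₁ | l₁
  · have : e₁ = 2 := by omega
    subst this
    rcases arith3_half_sharp h₁ h₂ h₃ he₂ he₃ hs with h | h | h | ⟨hN, hE₂, hE₃⟩
    · exact Or.inl h
    · exact Or.inr (Or.inl h)
    · exact Or.inr (Or.inr (Or.inl h))
    · exact Or.inr (Or.inr (Or.inr ⟨hN, Or.inl rfl, hE₂, hE₃⟩))
  rcases Nat.lt_or_ge e₂ 3 with l₂ | l₂
  · have : e₂ = 2 := by omega
    subst this
    have hs' : m₂ + m₁ + m₃ = N + 2 := by omega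
    rcases arith3_half_sharp h₂ h₁ h₃ he₁ he₃ hs' with h | h | h | ⟨hN, hE₁, hE₃⟩
    · exact Or.inr (Or.inl h)
    · exact Or.inl h
    · exact Or.inr (Or.inr (Or.inl h))
    · exact Or.inr (Or.inr (Or.inr ⟨hN, hE₁, Or.inl rfl, hE₃⟩))
  rcases Nat.lt_or_ge e₃ 3 with l₃ | l₃
  · have : e₃ = 2 := by omega
    subst this
    have hs' : m₃ + m₂ + m₁ = N + 2 := by omega
    rcases arith3_half_sharp h₃ h₂ h₁ he₂ he₁ hs' with h | h | h | ⟨hN, hE₂, hE₁⟩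
    · exact Or.inr (Or.inr (Or.inl h))
    · exact Or.inr (Or.inl h)
    · exact Or.inl h
    · exact Or.inr (Or.inr (Or.inr ⟨hN, hE₁, hE₂, Or.inl rfl⟩))
  exfalso
  nlinarith

/-! ### Element orders from stabiliser indices -/

variable {Γ : Type*} [Group Γ]

/-- If `K ⊴ Γ`, `K ≤ S` and `|S| = |K| · e`, then `γ ^ e ∈ K` for every `γ ∈ S`. -/
theorem pow_mem_of_card_eq [Finite Γ] {K S : Subgroup Γ} [K.Normal] (hKS : K ≤ S) {e : ℕ}
    (hcard : Nat.card S = Nat.card K * e) {γ : Γ} (hγ : γ ∈ S) : γ ^ e ∈ K := by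
  set K' : Subgroup S := K.subgroupOf S with hK'def
  haveI : K'.Normal := by rw [hK'def]; infer_instance
  have hK'card : Nat.card K' = Nat.card K := by
    rw [hK'def]
    exact Nat.card_congr (Subgroup.subgroupOfEquivOfLe hKS).toEquiv
  have hq : Nat.card (S ⧸ K') = e := by
    have h := Subgroup.card_eq_card_quotient_mul_card_subgroup K'
    rw [hK'card, hcard] at h
    have hKpos : 0 < Nat.card K := Nat.card_pos
    -- `|K| * e = |S ⧸ K'| * |K|`
    have : Nat.card K * e = Nat.card K * Nat.card (S ⧸ K') := by rw [h]; ring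
    exact (Nat.eq_of_mul_eq_mul_left hKpos this).symm
  have h1 : ((QuotientGroup.mk (s := K') (⟨γ, hγ⟩ : S)) : S ⧸ K') ^ e = 1 := by
    rw [← hq]
    exact pow_card_eq_one'
  rw [← QuotientGroup.mk_pow, QuotientGroup.eq_one_iff] at h1
  rw [hK'def, Subgroup.mem_subgroupOf] at h1
  simpa using h1

end TwoPointOrders

end Summit.MatrixMultiplication.MatrixMultiplication.Theorems.SubgroupIdentityDesigns.Negative
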